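import Summits.HodgeConjecture.HodgeConjecture.Theorems.H413ThetaDistAtLine
import Summits.HodgeConjecture.HodgeCM.Model.ArchLineSlotTypeTotal
import Summits.HodgeConjecture.HodgeCM.Model.ThetaAdelicSideGuardedT_1
import HarnessLib

/-!
# FLOOR-0 P4, S4b (4) ∕ PLAN v2 §6 (b) — the archimedean TEST DATA `A : ∀ k, ArchLineInput …` of `sideAt` AT THE LINE `a`,
# for ANY knob `(η, ν)`: the weights are READ OFF, no constraint on `μ`

Cell hodgecm-mathlib (D-0151), FLOOR 0, crux item H413 = stmt-HodgeConjecture-24833; programme P4, line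
`Cruxes/H413/Lines/F0_P4AdmissibleOccursInH1.lean` (ED. 2), stub S4b (lead F0P4-p01 (g0)).  Author F0P4-p04 (g0).
`--supports stmt-HodgeConjecture-24833 --as helper`.  KERNEL ONLY: three definitions with body (instantiations of LANDED model-layer
constructions at the degenerate seesaw context `cDiag Φ σ a` of ★ `Theorems/H413ThetaDistAtLine`) and `rfl` read-backs; nothing cited
as a fact, no `sorry`, no `Prop`-valued definition.

WHY.  ★ `H413ThetaDistAtLine.sideAt V Φ σ a ha ha0 η hη hηc ν hν hνc A` takes the archimedean test data
`A : ∀ k : Fin 4, ArchLineInput V (lineRepT V (cDiag …).D … η ν k)` — per slot a Schwartz test function `Φ_∞`, a rational base point with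
`Φ_∞(x₀) ≠ 0`, and a weight `w` with the (W-wt) law `ω(1, t_∞) φ_N = w(t_∞) • φ_N`.  The model's TOTAL line datum ★ `archLineDatumTotal`
(`ArchLineDatumTotal`) supplies it from four (J-μ) weight identities `hμₖ` over an integer weight table `μ : Fin 4 → (InfinitePlace L → ℤ)`,
and ★ `hμₖ_iff_charArchType` (`ArchLineSlotType`) says each identity IS an equation of integer vectors: `μ k = charArchType (etaInf … η k) +
charArchType (slotChiₖ · lineCTHom)`.  So for ANY knob `η` whose archimedean pull-backs `t ↦ ηₖ(1, u_t)` are continuous the identities hold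
with `μ := muAt` READ OFF the knob (★ `existsUnique_archWeight_eq`: a continuous character of the compact torus `U(1)(L⁺ ⊗ ℝ)` is an
`archWeight`) — the `A`-row of the S4b census imposes NO condition on the knob (census `CENSUS-S4b-archRows-generalMu` row 8).

* `muAt … η hηinf : Fin 4 → (InfinitePlace L → ℤ)` — the read-off weight table;
* `archLineDatumAt … η hηinf : ArchLineDatum V (cDiag …).D compat_* η (muAt …)` := ★ `archLineDatumTotal` fed by `(hμₖ_iff_charArchType …).2 rfl`;
* **`archLineInputAt … η hηinf ν k : ArchLineInput V (lineRepT V (cDiag …).D compat_* η ν k)`** := ★ `archLineInputT … ν k (archLineInputOf (archLineDatumAt …) k)`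
  (the ν-twist is invisible on `{1} × U(1)(𝔸)`, ★ `lineRepT_apply_one_left`) — THE `A` OF `sideAt`; read-back `archLineInputAt_w`.

Input left: `hηinf : ∀ k, Continuous (etaInf V (cDiag …).D η k)` (continuity of `t ↦ ηₖ(1, u_t)`; for a knob of the model's `EtaChi.η χV χW` shape it is
★ `continuous_etaInf_eta`).  HC_CM is proved only modulo the printed citations until rung 0 closes.

## References
* Tree (model layer, all ★): `HodgeCM/Model/ArchLineDatumTotal` (`archLineDatumTotal`), `HodgeCM/Model/ArchLineSlotType` (`etaInf`, `hμₖ_iff_charArchType`,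
  `charArchType`), `HodgeCM/Model/ArchLineSlotTypeTotal` (`lineCTHom`, `slotTypeTVec`, `continuous_slotChiₖ_mul_lineCTHom`), `HodgeCM/Model/ArchLineInputOf`
  (`archLineInputOf`), `HodgeCM/Model/ThetaAdelicSideGuardedT` (`archLineInputT`), `Literature/NumberTheory/Automorphic/UnitaryLineArchExponents`
  (`existsUnique_archWeight_eq`), ★ `Theorems/H413ThetaDistAtLine` (`cDiag`, `compat_*`, `h₁W_cDiag`, `sideAt`).
* [BrockerTomDieck1985] T. Bröcker, T. tom Dieck, *Representations of Compact Lie Groups* (1985), Ch. II Prop. 8.1 (characters of tori).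
* [Liu2021] Y. Liu, Camb. J. Math. 9 (2021) = arXiv:2102.11518, App. D Lem. D.2.
-/

set_option autoImplicit false
set_option linter.dupNamespace false

noncomputable section

open NumberField hiding relNormOneIdeles relNormOneRat probHaarRelNormOneQuot
open _root_.NumberField.InfinitePlace _root_.NumberField.mixedEmbedding MeasureTheory MulAction IsDedekindDomain
open scoped Matrix TensorProduct Classical SchwartzMap
open Literature.NumberTheory.Automorphic Literature.NumberTheory.Automorphic.UnitaryGroup Literature.NumberTheory.Weil1964
open Literature.NumberTheory.GelbartRogawski1991 Literature.NumberTheory.GelbartRogawski1991.UnitaryDualPair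
open Literature.AlgebraicGeometry.ShimuraVarieties
open Literature.AlgebraicGeometry.Motives (CMType)
open HodgeCM HodgeCM.Adelic HodgeCM.PerL34 HodgeCM.Model HodgeCM.Model.HypCensus HodgeCM.Model.ArchSideTerm
open HodgeCM.Model.ThetaAdelicSide HodgeCM.Model.SupplyInstance

namespace Summit.HodgeConjecture.HodgeConjecture.Cruxes.H413.ThetaDistAtLine

variable {L : CMField} {ι₁ : L →+* ℂ} (V : HermSpace3 L ι₁)
variable (Φ : CMType (L : Type)) (σ : (L : Type) →+* ℂ) (a : (L : Type)) (ha : IsCMField.complexConj (L : Type) a = a) (ha0 : a ≠ 0)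
variable (η : CMAdelic (L : Type) (frameD V) × CMAdelic (L : Type) (dW (cDiag Φ σ a ha ha0).D) →* ℂˣ)
  (hηinf : ∀ k : Fin 4, Continuous (etaInf V (cDiag Φ σ a ha ha0).D η k))
  (ν : CMAdelic (L : Type) (frameD V) →* ℂˣ)

/-- **the weight table READ OFF the knob**: `μ k := charArchType (t ↦ ηₖ(1, u_t)) + slotTypeₖ` (the type of the slot's see-saw scalar times the total
centre eigenvalue `lineCT`), so that the four (J-μ) identities of `ArchLineDatum` hold by construction.  [cite: BrockerTomDieck1985, Ch. II Prop. 8.1] -/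
def muAt : Fin 4 → (InfinitePlace (L : Type) → ℤ) := fun k =>
  charArchType (L : Type) (etaInf V (cDiag Φ σ a ha ha0).D η k) (hηinf k) +
    slotTypeTVec V (cDiag Φ σ a ha ha0) (compat_plane V Φ σ a ha ha0) (compat_line₀ V Φ σ a ha ha0) (compat_line₁ V Φ σ a ha ha0)
      (compat_line₂ V Φ σ a ha ha0) (compat_line₃ V Φ σ a ha ha0) (h₁W_cDiag Φ σ a ha ha0) k

/-- slot `0` of the read-off table. -/
theorem muAt_zero : muAt V Φ σ a ha ha0 η hηinf 0 =
    charArchType (L : Type) (etaInf V (cDiag Φ σ a ha ha0).D η 0) (hηinf 0) +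
      charArchType (L : Type) _ (continuous_slotChi₀_mul_lineCTHom V (cDiag Φ σ a ha ha0) (compat_plane V Φ σ a ha ha0)
        (compat_line₀ V Φ σ a ha ha0) (compat_line₁ V Φ σ a ha ha0) (h₁W_cDiag Φ σ a ha ha0)) := rfl

/-- slot `1` of the read-off table. -/
theorem muAt_one : muAt V Φ σ a ha ha0 η hηinf 1 =
    charArchType (L : Type) (etaInf V (cDiag Φ σ a ha ha0).D η 1) (hηinf 1) +
      charArchType (L : Type) _ (continuous_slotChi₁_mul_lineCTHom V (cDiag Φ σ a ha ha0) (compat_plane V Φ σ a ha ha0)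
        (compat_line₀ V Φ σ a ha ha0) (compat_line₁ V Φ σ a ha ha0) (h₁W_cDiag Φ σ a ha ha0)) := rfl

/-- slot `2` of the read-off table. -/
theorem muAt_two : muAt V Φ σ a ha ha0 η hηinf 2 =
    charArchType (L : Type) (etaInf V (cDiag Φ σ a ha ha0).D η 2) (hηinf 2) +
      charArchType (L : Type) _ (continuous_slotChi₂_mul_lineCTHom V (cDiag Φ σ a ha ha0) (compat_plane V Φ σ a ha ha0)
        (compat_line₂ V Φ σ a ha ha0) (compat_line₃ V Φ σ a ha ha0) (h₁W_cDiag Φ σ a ha ha0)) := rfl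

/-- slot `3` of the read-off table. -/
theorem muAt_three : muAt V Φ σ a ha ha0 η hηinf 3 =
    charArchType (L : Type) (etaInf V (cDiag Φ σ a ha ha0).D η 3) (hηinf 3) +
      charArchType (L : Type) _ (continuous_slotChi₃_mul_lineCTHom V (cDiag Φ σ a ha ha0) (compat_plane V Φ σ a ha ha0)
        (compat_line₂ V Φ σ a ha ha0) (compat_line₃ V Φ σ a ha ha0) (h₁W_cDiag Φ σ a ha ha0)) := rfl

/-- **the archimedean line datum AT THE LINE `a` for ANY knob `η`**: the model's TOTAL datum (★ `archLineDatumTotal`: honest test function, rational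
base point and centre eigenvalue in both sign branches of each slot) with its four (J-μ) identities DISCHARGED at the read-off table `muAt` by
★ `hμₖ_iff_charArchType`. [cite: BrockerTomDieck1985, Ch. II Prop. 8.1] -/
def archLineDatumAt :
    ArchLineDatum V (cDiag Φ σ a ha ha0).D (compat_plane V Φ σ a ha ha0) (compat_line₀ V Φ σ a ha ha0) (compat_line₁ V Φ σ a ha ha0)
      (compat_line₂ V Φ σ a ha ha0) (compat_line₃ V Φ σ a ha ha0) η (muAt V Φ σ a ha ha0 η hηinf) :=
  archLineDatumTotal V (cDiag Φ σ a ha ha0).D (compat_plane V Φ σ a ha ha0) (compat_line₀ V Φ σ a ha ha0) (compat_line₁ V Φ σ a ha ha0)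
    (compat_line₂ V Φ σ a ha ha0) (compat_line₃ V Φ σ a ha ha0) η (muAt V Φ σ a ha ha0 η hηinf)
    ((hμ₀_iff_charArchType V (cDiag Φ σ a ha ha0).D (compat_plane V Φ σ a ha ha0) (compat_line₀ V Φ σ a ha ha0)
        (compat_line₁ V Φ σ a ha ha0) η (hηinf 0)
        (lineCTHom V (dW (cDiag Φ σ a ha ha0).D 0) (dW_real (cDiag Φ σ a ha ha0).D 0) (dW_ne (cDiag Φ σ a ha ha0).D 0)
          (compat_line₀ V Φ σ a ha ha0))
        (continuous_slotChi₀_mul_lineCTHom V (cDiag Φ σ a ha ha0) (compat_plane V Φ σ a ha ha0) (compat_line₀ V Φ σ a ha ha0)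
          (compat_line₁ V Φ σ a ha ha0) (h₁W_cDiag Φ σ a ha ha0))
        (muAt V Φ σ a ha ha0 η hηinf 0)).2 (muAt_zero V Φ σ a ha ha0 η hηinf).symm)
    ((hμ₁_iff_charArchType V (cDiag Φ σ a ha ha0).D (compat_plane V Φ σ a ha ha0) (compat_line₀ V Φ σ a ha ha0)
        (compat_line₁ V Φ σ a ha ha0) η (hηinf 1)
        (lineCTHom V (dW (cDiag Φ σ a ha ha0).D 1) (dW_real (cDiag Φ σ a ha ha0).D 1) (dW_ne (cDiag Φ σ a ha ha0).D 1)
          (compat_line₁ V Φ σ a ha ha0))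
        (continuous_slotChi₁_mul_lineCTHom V (cDiag Φ σ a ha ha0) (compat_plane V Φ σ a ha ha0) (compat_line₀ V Φ σ a ha ha0)
          (compat_line₁ V Φ σ a ha ha0) (h₁W_cDiag Φ σ a ha ha0))
        (muAt V Φ σ a ha ha0 η hηinf 1)).2 (muAt_one V Φ σ a ha ha0 η hηinf).symm)
    ((hμ₂_iff_charArchType V (cDiag Φ σ a ha ha0).D (compat_plane V Φ σ a ha ha0) (compat_line₂ V Φ σ a ha ha0)
        (compat_line₃ V Φ σ a ha ha0) η (hηinf 2)
        (lineCTHom V (dW' (cDiag Φ σ a ha ha0).D 0) (dW'_real (cDiag Φ σ a ha ha0).D 0) (dW'_ne (cDiag Φ σ a ha ha0).D 0)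
          (compat_line₂ V Φ σ a ha ha0))
        (continuous_slotChi₂_mul_lineCTHom V (cDiag Φ σ a ha ha0) (compat_plane V Φ σ a ha ha0) (compat_line₂ V Φ σ a ha ha0)
          (compat_line₃ V Φ σ a ha ha0) (h₁W_cDiag Φ σ a ha ha0))
        (muAt V Φ σ a ha ha0 η hηinf 2)).2 (muAt_two V Φ σ a ha ha0 η hηinf).symm)
    ((hμ₃_iff_charArchType V (cDiag Φ σ a ha ha0).D (compat_plane V Φ σ a ha ha0) (compat_line₂ V Φ σ a ha ha0)
        (compat_line₃ V Φ σ a ha ha0) η (hηinf 3)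
        (lineCTHom V (dW' (cDiag Φ σ a ha ha0).D 1) (dW'_real (cDiag Φ σ a ha ha0).D 1) (dW'_ne (cDiag Φ σ a ha ha0).D 1)
          (compat_line₃ V Φ σ a ha ha0))
        (continuous_slotChi₃_mul_lineCTHom V (cDiag Φ σ a ha ha0) (compat_plane V Φ σ a ha ha0) (compat_line₂ V Φ σ a ha ha0)
          (compat_line₃ V Φ σ a ha ha0) (h₁W_cDiag Φ σ a ha ha0))
        (muAt V Φ σ a ha ha0 η hηinf 3)).2 (muAt_three V Φ σ a ha ha0 η hηinf).symm)

/-- **THE ARCHIMEDEAN TEST DATA OF `sideAt` AT THE LINE `a`, FOR ANY KNOB `(η, ν)`** — the `A` binder of ★ `H413ThetaDistAtLine.sideAt`, all four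
slots: ★ `archLineInputOf` of the read-off datum, transported along the ν-twist (★ `archLineInputT`: on `{1} × U(1)(𝔸)` the twist is invisible).
No hypothesis on the knob beyond the continuity `hηinf`. [cite: Liu2021, App. D Lem. D.2] -/
def archLineInputAt (k : Fin 4) :
    ArchLineInput V (lineRepT V (cDiag Φ σ a ha ha0).D (compat_plane V Φ σ a ha ha0) (compat_line₀ V Φ σ a ha ha0)
      (compat_line₁ V Φ σ a ha ha0) (compat_line₂ V Φ σ a ha ha0) (compat_line₃ V Φ σ a ha ha0) η ν k) :=
  archLineInputT V (cDiag Φ σ a ha ha0).D (compat_plane V Φ σ a ha ha0) (compat_line₀ V Φ σ a ha ha0) (compat_line₁ V Φ σ a ha ha0)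
    (compat_line₂ V Φ σ a ha ha0) (compat_line₃ V Φ σ a ha ha0) η ν k (archLineInputOf (archLineDatumAt V Φ σ a ha ha0 η hηinf) k)

/-- read-back: the weight of slot `k` is LITERALLY `archWeight L (muAt … k)`. -/
theorem archLineInputAt_w (k : Fin 4) :
    (archLineInputAt V Φ σ a ha ha0 η hηinf ν k).w = Literature.NumberTheory.Automorphic.archWeight (L : Type) (muAt V Φ σ a ha ha0 η hηinf k) :=
  rfl

/-! ## §2 (ED. 2) The continuity input `hηinf` from the continuity of the knob -/

/-- **`hηinf` from `hηc`**: for ANY seesaw datum `S` and any knob `η` whose values are continuous, the four archimedean pull-backs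
`t ↦ ηₖ(1, u_t)` (`etaInf … η k`) are continuous — the `ηₖ` are `η` along continuous torus embeddings (★ `continuous_cmEta₀` ∕
`continuous_cmEta₁_comp_snd` ∕ `continuous_cmConjEta₀` ∕ `continuous_cmConjEta₁_comp_snd`) and `t ↦ (1, u_t)` is continuous
(★ `continuous_infUnitToOne`).  So `archLineInputAt … η (continuous_etaInf_of_continuous V η hηc) ν` needs only `hηc`. [cite: Liu2021, App. D Lem. D.2] -/
theorem continuous_etaInf_of_continuous {S : StubTree.SeesawDatum L}
    (η : CMAdelic (L : Type) (frameD V) × CMAdelic (L : Type) (dW S) →* ℂˣ) (hηc : Continuous fun p => ((η p : ℂˣ) : ℂ)) (k : Fin 4) :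
    Continuous (etaInf V S η k) := by
  have h1 : Continuous fun t : ↥(Literature.NumberTheory.Automorphic.relNormOneInfUnits (↥(maximalRealSubfield (L : Type))) (L : Type)) =>
      ((1 : CMAdelic (L : Type) (frameD V)), infUnitToOne (L : Type) t) :=
    continuous_const.prodMk (continuous_infUnitToOne (L : Type))
  fin_cases k
  · exact (continuous_cmEta₀ (L : Type) (frameD V) (dW S) η hηc).comp h1
  · exact (continuous_cmEta₁_comp_snd (L : Type) (frameD V) (dW S) η hηc).comp h1
  · exact (continuous_cmConjEta₀ (L : Type) (frameD V) (dW S) (dW' S) S.isoGL (isoGL_hg₀ S) η hηc).comp h1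
  · exact (continuous_cmConjEta₁_comp_snd (L : Type) (frameD V) (dW S) (dW' S) S.isoGL (isoGL_hg₀ S) η hηc).comp h1

end Summit.HodgeConjecture.HodgeConjecture.Cruxes.H413.ThetaDistAtLine

end
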